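import Literature.Algebra.Homology.OrderedCechSystemMap
import Mathlib.Algebra.Homology.Single
import HarnessLib

/-!
# The augmentation of the ordered Čech complex of a system from its empty member (Görtz–Wedhorn II Lemma 21.65; Stacks 01FG)

Layer `Literature/Algebra/Homology` (constructions + proved lemmas; 0 named facts, no instance, no notation; pure homological
algebra over a commutative ring `A`). A system of `A`-modules `N : Finset κ ⥤ ModuleCat A` on the finite subsets of a linearly
ordered `κ` has a member `N ∅` at the EMPTY set which the ordered Čech complex `Č•(N) = sysComplex N` (`Algebra/Homology/OrderedCechSystem`,
simplices = non-empty subsets) never uses; it maps to every other member (`∅ ⊆ t`), and this is the AUGMENTATION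
`ε : N ∅ → Č⁰(N) = Π_i N {i}`, `g ↦ (N(∅ ⊆ {i}) g)_i`, with `d⁰ ∘ ε = 0`. Geometrically (`N = sectionsSystem 𝓥 L ρ` of
`Modules/ModuleCechComplex`, `N ∅ = Γ(L, X)` since `V_∅ = X`) this is the augmentation `Γ(L, X) → Č⁰(𝓥, L)`, `t ↦ (t|_{V_i})_i` of
`Modules/ModuleCechHZero.cechAugment` (Görtz–Wedhorn II Lemma 21.65) — the special case is cited, not imported or restated.

* `sysAugment N : N.obj ∅ →ₗ[A] SysCochain N 0`, `sysAugment_apply` (`rfl`), **`sysD_sysAugment`** (`d⁰ ∘ ε = 0`, via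
  `sysD_zero_eq_zero_iff`), naturality in the system `sysCochainMap_sysAugment`;
* **`sysAugmentHom N : (N ∅)[0] ⟶ Č•(N)`** — the augmentation as a chain map out of the one-term complex (Mathlib
  `HomologicalComplex.mkHomFromSingle`), `sysAugmentHom_f_zero`, and the naturality square `sysAugmentHom_naturality` with
  `sysComplexMap` (`Algebra/Homology/OrderedCechSystemMap`).

Library only (cell `pub-hodge-ring2`, count-neutral); proves nothing about any crux, route or conjecture. Mathlib searched (pin v4.32):
`HomologicalComplex.single`, `mkHomFromSingle` (+ `_f`), `from_single_hom_ext`, `single_map_f_self`, `singleObjXSelf`, `homOfLE`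
(used); no augmented ordered Čech complex of a system of modules.

## References

* U. Görtz, T. Wedhorn, *Algebraic Geometry II* (2023), Lemma 21.65, Def. 21.68 (pp. 179–180). [GortzWedhorn2023]
* The Stacks Project, Tag 01FG (ordered Čech complex), Tag 0BEC. [StacksProject]
-/

universe v u

open CategoryTheory HomologicalComplex

set_option backward.isDefEq.respectTransparency false

noncomputable section

namespace Literature.Algebra.Homology

namespace OrderedCech

variable {κ : Type} [LinearOrder κ] {A : Type u} [CommRing A]

section Augment

variable (N : Finset κ ⥤ ModuleCat.{v} A)

/-- **The augmentation `ε : N ∅ → Č⁰(N)`**, `g ↦ (N(∅ ⊆ {i}) g)_i`, from the empty member of a system to its `0`-cochains.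
[cite: GortzWedhorn2023, Lemma 21.65 (p. 179)] -/
def sysAugment : N.obj ∅ →ₗ[A] SysCochain N 0 :=
  LinearMap.pi fun τ => (N.map (homOfLE (Finset.empty_subset τ.1))).hom

/-- Components of the augmentation (`rfl`). [cite: GortzWedhorn2023, Lemma 21.65 (p. 179)] -/
@[simp] theorem sysAugment_apply (g : N.obj ∅) (τ : Simplex κ 0) :
    sysAugment N g τ = (N.map (homOfLE (Finset.empty_subset τ.1))).hom g := rfl

/-- **`d⁰ ∘ ε = 0`**: the augmentation lands in the `0`-cocycles (both restrictions of `(ε g)` to an edge `{a, b}` are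
`N(∅ ⊆ {a, b}) g`). [cite: GortzWedhorn2023, Lemma 21.65 (p. 179)] -/
theorem sysD_sysAugment (g : N.obj ∅) : sysD N 0 (sysAugment N g) = 0 := by
  rw [sysD_zero_eq_zero_iff]
  intro a b hab
  have hc : ∀ {s t : Finset κ} (f : (∅ : Finset κ) ⟶ s) (f' : s ⟶ t) (x : N.obj ∅),
      (N.map f').hom ((N.map f).hom x) = (N.map (f ≫ f')).hom x := fun f f' x => by
    rw [N.map_comp]
    rfl
  erw [sysAugment_apply, sysAugment_apply, hc, hc]
  rfl

/-- `ε` is injective as soon as one of the maps `N(∅ ⊆ {i})` is. [cite: GortzWedhorn2023, Lemma 21.65 (p. 179)] -/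
theorem sysAugment_injective_of (i : κ) (hi : Function.Injective (N.map (homOfLE (Finset.empty_subset {i}))).hom) :
    Function.Injective (sysAugment N) :=
  fun _ _ h => hi (congr_fun h (vertex i))

/-- **The augmentation as a chain map `(N ∅)[0] ⟶ Č•(N)`** out of the one-term complex (Mathlib `mkHomFromSingle`; the condition
`ε ≫ d⁰ = 0` is `sysD_sysAugment`). [cite: GortzWedhorn2023, Lemma 21.65 and Def. 21.68 (pp. 179–180)] [cite: StacksProject, Tag 01FG] -/
def sysAugmentHom : (single (ModuleCat.{v} A) (ComplexShape.up ℤ) 0).obj (N.obj ∅) ⟶ sysComplex N :=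
  mkHomFromSingle (ModuleCat.ofHom (sysAugment N)) fun k hk => by
    obtain rfl : (0 : ℤ) + 1 = k := hk
    rw [sysComplex_d]
    ext g
    exact sysD_sysAugment N g

/-- The degree-`0` component of `sysAugmentHom` is `ε` (up to `singleObjXSelf`). [cite: GortzWedhorn2023, Lemma 21.65 (p. 179)] -/
@[simp] theorem sysAugmentHom_f_zero :
    (sysAugmentHom N).f 0 = (singleObjXSelf (ComplexShape.up ℤ) 0 (N.obj ∅)).hom ≫ ModuleCat.ofHom (sysAugment N) :=
  mkHomFromSingle_f _ _

end Augment

/-! ### Naturality in the system -/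

section Naturality

variable {N N' : Finset κ ⥤ ModuleCat.{v} A} (φ : N ⟶ N')

/-- **Naturality of `ε`**: `Č⁰(φ) (ε_N g) = ε_{N'} (φ_∅ g)`. [cite: GortzWedhorn2023, Lemma 21.65 (p. 179)] -/
theorem sysCochainMap_sysAugment (g : N.obj ∅) :
    sysCochainMap φ 0 (sysAugment N g) = sysAugment N' ((φ.app ∅).hom g) := by
  funext τ
  rw [sysCochainMap_apply, sysAugment_apply, sysAugment_apply, ← ModuleCat.comp_apply, ← ModuleCat.comp_apply,
    φ.naturality]

/-- **Naturality of the augmentation chain map**: `φ_∅[0] ≫ ε_{N'} = ε_N ≫ Č•(φ)`. [cite: GortzWedhorn2023, Lemma 21.65 (p. 179)]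
[cite: StacksProject, Tag 01FG] -/
theorem sysAugmentHom_naturality :
    (single (ModuleCat.{v} A) (ComplexShape.up ℤ) 0).map (φ.app ∅) ≫ sysAugmentHom N' =
      sysAugmentHom N ≫ sysComplexMap φ := by
  apply from_single_hom_ext
  rw [comp_f, comp_f, single_map_f_self, sysAugmentHom_f_zero, sysAugmentHom_f_zero, sysComplexMap_f]
  simp only [Category.assoc, Iso.inv_hom_id_assoc]
  congr 1
  ext g
  exact (sysCochainMap_sysAugment φ g).symm

end Naturality

end OrderedCech

end Literature.Algebra.Homology

end
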